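import Summits.QuantumAdvantage.QuantumAdvantage.Theorems.LinnikCubicClassGroupsDegreeOnePrimesEscapeSymmetricCycleTypes
import Mathlib.GroupTheory.SpecificGroups.Alternating
import HarnessLib

/-!
# Frobenius divisions in `S_n` and splitting types: the dictionary

Topic `Summits/QuantumAdvantage/QuantumAdvantage/Theorems`, cell B2b-1 (linnik-cubic), PART A (gen 11);
helper toward the crux `DegreeOnePrimesEscape` (stmt-QuantumAdvantage-11543) of route
`LinnikCubicClassGroups`.  HONEST FRAMING: the value of this file is a THEOREM (kernel-checked group theory
and Dedekind–Frobenius bookkeeping) — NOT summit progress.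

The division prime number theorems of this cell (`division_PNT`, `division_PNT_pi`, …) count primes by the
DIVISION `Div σ = {τ : ⟨gτg⁻¹⟩ = ⟨σ⟩}` of their Frobenius.  In the symmetric group every division is a
conjugacy class, and conjugacy classes are cycle types; for an `S_n`-field `K` (embedded `S_n`-closure
`N`, `ψ : Gal(N/ℚ) ≃* Perm (Fin n)` with `Gal(N/K')` the stabiliser of `0`, `symmetricClosure`) the cycle
type of `ψ(Frob_p)`, padded with fixed points, is the splitting type of `p` in `K` (Dedekind).  This file
proves the dictionary in the form consumed by the `π`-form division PNT:

* `exists_conj_zpowers_eq_iff_fullCycleType_eq` — in `Perm α`: `τ ∈ Div σ ↔` the full cycle types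
  (`cycleType + (#fixed points)·{1}`) of `τ` and `σ` agree (fixed points of the powers only see the cyclic
  group; equal cycle types are conjugate, Mathlib `isConj_of_cycleType_eq`);
* `sign_eq_neg_one_pow_card_sub` — `sign τ = (−1)^{|α| − #parts of the full cycle type}`;
* `natCard_division_eq_card_filter_fullCycleType` — `|Div σ|` transported along `ψ : G ≃* Perm (Fin n)` is
  the number of permutations with the full cycle type of `ψ σ`;
* `mem_iff_sign_eq_one_of_index_two` — an index-`2` subgroup of `G ≃* S_n` is `{sign ∘ ψ = 1}`
  (Mathlib `eq_alternatingGroup_of_index_eq_two`);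
* `frobenius_division_iff_splittingType_eq` — for a prime `p ∤ d_N`: (`∃ Q ∣ p` with trivial inertia and
  Frobenius `φ`, `⟨gφg⁻¹⟩ = ⟨σ⟩`) `↔ splittingType K' p =` full cycle type of `ψ σ`.

References: R. Dedekind (1894) / Perlis, J. Number Theory 9 (1977) §1 [Perlis1977];
J. C. Lagarias, H. L. Montgomery, A. M. Odlyzko, Invent. Math. 54 (1979) [LagariasMontgomeryOdlyzko1979].
-/

noncomputable section

open scoped NumberField nonZeroDivisors
open Finset Ideal NumberField
open Literature.NumberTheory.NumberFields Literature.NumberTheory.LFunctions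
  Literature.NumberTheory.LFunctions.NumberField

namespace Summit.QuantumAdvantage.QuantumAdvantage.Theorems.DegreeOnePrimesEscape

/-! ### Divisions of the symmetric group are full cycle types -/

section Perm

variable {α : Type*} [Fintype α] [DecidableEq α]

/-- Conjugation does not change the number of fixed points. -/
theorem card_filter_fixed_conj (g σ : Equiv.Perm α) :
    (Finset.univ.filter fun x : α => (g * σ * g⁻¹) x = x).card =
      (Finset.univ.filter fun x : α => σ x = x).card := by
  refine (Finset.card_bij (fun x _ => g⁻¹ x) ?_ ?_ ?_)
  · intro x hx
    rw [Finset.mem_filter] at hx ⊢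
    refine ⟨Finset.mem_univ _, ?_⟩
    have h := hx.2
    rw [Equiv.Perm.mul_apply, Equiv.Perm.mul_apply] at h
    exact Equiv.Perm.eq_inv_iff_eq.mpr h
  · intro x _ y _ h
    exact g⁻¹.injective h
  · intro y hy
    rw [Finset.mem_filter] at hy
    refine ⟨g y, ?_, by simp⟩
    rw [Finset.mem_filter]
    refine ⟨Finset.mem_univ _, ?_⟩
    rw [Equiv.Perm.mul_apply, Equiv.Perm.mul_apply]
    simp [hy.2]

/-- Generators of the same cyclic subgroup have the same fixed points. -/
theorem filter_fixed_eq_of_zpowers_eq {a b : Equiv.Perm α} (h : Subgroup.zpowers a = Subgroup.zpowers b) :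
    (Finset.univ.filter fun x : α => a x = x) = (Finset.univ.filter fun x : α => b x = x) := by
  have key : ∀ {a b : Equiv.Perm α}, Subgroup.zpowers a = Subgroup.zpowers b →
      (Finset.univ.filter fun x : α => a x = x) ⊆ (Finset.univ.filter fun x : α => b x = x) := by
    intro a b h x hx
    rw [Finset.mem_filter] at hx ⊢
    have hb : b ∈ Subgroup.zpowers a := h ▸ Subgroup.mem_zpowers b
    obtain ⟨k, rfl⟩ := Subgroup.mem_zpowers_iff.mp hb
    exact ⟨hx.1, Equiv.Perm.zpow_apply_eq_self_of_apply_eq_self hx.2 k⟩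
  exact Finset.Subset.antisymm (key h) (key h.symm)

/-- The entries `≥ 2` of the full cycle type are the cycle type. -/
theorem filter_two_le_fullCycleType (σ : Equiv.Perm α) :
    (σ.cycleType + Multiset.replicate (Fintype.card α - σ.support.card) 1).filter (2 ≤ ·) = σ.cycleType := by
  rw [Multiset.filter_add, Multiset.filter_eq_self.mpr (fun c hc => Equiv.Perm.two_le_of_mem_cycleType hc),
    Multiset.filter_eq_nil.mpr (fun c hc => by rw [Multiset.eq_of_mem_replicate hc]; omega), add_zero]

/-- Equal full cycle types have equal cycle types. -/
theorem cycleType_eq_of_fullCycleType_eq {σ τ : Equiv.Perm α}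
    (h : σ.cycleType + Multiset.replicate (Fintype.card α - σ.support.card) 1 =
      τ.cycleType + Multiset.replicate (Fintype.card α - τ.support.card) 1) :
    σ.cycleType = τ.cycleType := by
  rw [← filter_two_le_fullCycleType σ, ← filter_two_le_fullCycleType τ, h]

/-- **Divisions in the symmetric group are full cycle types**: `τ` lies in the division of `σ`
(`⟨gτg⁻¹⟩ = ⟨σ⟩` for some `g`) iff the full cycle types of `τ` and `σ` agree. -/
theorem exists_conj_zpowers_eq_iff_fullCycleType_eq (σ τ : Equiv.Perm α) :
    (∃ g : Equiv.Perm α, Subgroup.zpowers (g * τ * g⁻¹) = Subgroup.zpowers σ) ↔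
      τ.cycleType + Multiset.replicate (Fintype.card α - τ.support.card) 1 =
        σ.cycleType + Multiset.replicate (Fintype.card α - σ.support.card) 1 := by
  constructor
  · rintro ⟨g, hg⟩
    -- the fixed points of all powers agree, hence the full cycle types
    have hsums : ∀ j : ℕ,
        ((τ.cycleType + Multiset.replicate (Fintype.card α - τ.support.card) 1).filter (· ∣ j)).sum =
          ((σ.cycleType + Multiset.replicate (Fintype.card α - σ.support.card) 1).filter (· ∣ j)).sum := by
      intro j
      rw [sum_filter_dvd_fullCycleType, sum_filter_dvd_fullCycleType,
        ← filter_fixed_eq_of_zpowers_eq (zpowers_pow_eq_of_zpowers_eq hg j), conj_pow,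
        card_filter_fixed_conj]
    exact eq_of_forall_sum_filter_dvd_eq _ _ _ rfl (fun f hf => pos_of_mem_fullCycleType τ hf)
      (fun f hf => pos_of_mem_fullCycleType σ hf) hsums
  · intro h
    obtain ⟨c, hc⟩ := isConj_iff.mp (Equiv.Perm.isConj_of_cycleType_eq (cycleType_eq_of_fullCycleType_eq h))
    exact ⟨c, by rw [hc]⟩

/-- The number of parts of the full cycle type: `#parts + Σ cycleType = |α| + #cycleType`. -/
theorem card_fullCycleType_add (σ : Equiv.Perm α) :
    Multiset.card (σ.cycleType + Multiset.replicate (Fintype.card α - σ.support.card) 1) + σ.cycleType.sum =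
      Fintype.card α + Multiset.card σ.cycleType := by
  rw [Multiset.card_add, Multiset.card_replicate, Equiv.Perm.sum_cycleType]
  have := Finset.card_le_univ σ.support
  omega

/-- **The sign from the full cycle type**: `sign τ = (−1)^{|α| − #parts}`. -/
theorem sign_eq_neg_one_pow_card_sub (σ : Equiv.Perm α) :
    Equiv.Perm.sign σ =
      (-1) ^ (Fintype.card α - Multiset.card (σ.cycleType + Multiset.replicate (Fintype.card α - σ.support.card) 1)) := by
  rw [Equiv.Perm.sign_of_cycleType]
  have h := card_fullCycleType_add σ
  have hle : Multiset.card σ.cycleType ≤ σ.cycleType.sum := by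
    have h2 : ∀ c ∈ σ.cycleType, 1 ≤ c := fun c hc => le_trans (by norm_num) (Equiv.Perm.two_le_of_mem_cycleType hc)
    simpa using Multiset.card_nsmul_le_sum h2
  set A := Multiset.card (σ.cycleType + Multiset.replicate (Fintype.card α - σ.support.card) 1)
  have hA : Fintype.card α - A = σ.cycleType.sum - Multiset.card σ.cycleType := by omega
  rw [hA]
  rw [show σ.cycleType.sum + Multiset.card σ.cycleType =
      (σ.cycleType.sum - Multiset.card σ.cycleType) + 2 * Multiset.card σ.cycleType by omega,
    pow_add, pow_mul, neg_one_sq, one_pow, mul_one]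
  rfl

end Perm

/-! ### Transport along `ψ : G ≃* Perm (Fin n)` -/

/-- Transport of `⟨g z g⁻¹⟩ = ⟨σ⟩` along a group isomorphism. -/
theorem zpowers_conj_eq_of_mulEquiv {G H : Type*} [Group G] [Group H] (ψ : G ≃* H) {g z σ : G}
    (hg : Subgroup.zpowers (g * z * g⁻¹) = Subgroup.zpowers σ) :
    Subgroup.zpowers (ψ g * ψ z * (ψ g)⁻¹) = Subgroup.zpowers (ψ σ) := by
  have h1 : ∀ x : G, Subgroup.zpowers (ψ x) = (Subgroup.zpowers x).map ψ.toMonoidHom := fun x => by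
    rw [MonoidHom.map_zpowers]; rfl
  rw [← map_inv, ← map_mul, ← map_mul, h1, h1, hg]

section Transport

variable {n : ℕ} {G : Type*} [Group G] (ψ : G ≃* Equiv.Perm (Fin n))

/-- **`|Div σ|` is the number of permutations with the full cycle type of `ψ σ`.** -/
theorem natCard_division_eq_card_filter_fullCycleType (σ : G) :
    Nat.card {z : G // ∃ g : G, Subgroup.zpowers (g * z * g⁻¹) = Subgroup.zpowers σ} =
      (Finset.univ.filter fun q : Equiv.Perm (Fin n) =>
        q.cycleType + Multiset.replicate (n - q.support.card) 1 =
          (ψ σ).cycleType + Multiset.replicate (n - (ψ σ).support.card) 1).card := by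
  classical
  have e : {z : G // ∃ g : G, Subgroup.zpowers (g * z * g⁻¹) = Subgroup.zpowers σ} ≃
      {q : Equiv.Perm (Fin n) // ∃ g : Equiv.Perm (Fin n),
        Subgroup.zpowers (g * q * g⁻¹) = Subgroup.zpowers (ψ σ)} :=
    { toFun := fun z => ⟨ψ z.1, by
        obtain ⟨g, hg⟩ := z.2
        exact ⟨ψ g, zpowers_conj_eq_of_mulEquiv ψ hg⟩⟩
      invFun := fun q => ⟨ψ.symm q.1, by
        obtain ⟨g, hg⟩ := q.2
        refine ⟨ψ.symm g, ?_⟩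
        have := zpowers_conj_eq_of_mulEquiv ψ.symm hg
        rwa [MulEquiv.symm_apply_apply] at this⟩
      left_inv := fun z => Subtype.ext (ψ.symm_apply_apply z.1)
      right_inv := fun q => Subtype.ext (ψ.apply_symm_apply q.1) }
  rw [Nat.card_congr e, Nat.card_eq_fintype_card, Fintype.card_subtype]
  refine Finset.card_bij (fun q _ => q) (fun q hq => ?_) (fun _ _ _ _ h => h) (fun q hq => ⟨q, ?_, rfl⟩)
  · rw [Finset.mem_filter] at hq ⊢
    have h := (exists_conj_zpowers_eq_iff_fullCycleType_eq (ψ σ) q).mp hq.2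
    simp only [Fintype.card_fin] at h
    exact ⟨Finset.mem_univ _, h⟩
  · rw [Finset.mem_filter] at hq ⊢
    refine ⟨Finset.mem_univ _, (exists_conj_zpowers_eq_iff_fullCycleType_eq (ψ σ) q).mpr ?_⟩
    simp only [Fintype.card_fin]
    exact hq.2

/-- **An index-two subgroup of `G ≃* S_n` is the kernel of `sign ∘ ψ`.** -/
theorem mem_iff_sign_eq_one_of_index_two (K₁ : Subgroup G) (hK₁ : K₁.index = 2) (z : G) :
    z ∈ K₁ ↔ Equiv.Perm.sign (ψ z) = 1 := by
  classical
  have hmap : (K₁.map ψ.toMonoidHom).index = 2 := by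
    rw [Subgroup.index_map_of_bijective ψ.bijective, hK₁]
  have heq := Equiv.Perm.eq_alternatingGroup_of_index_eq_two hmap
  rw [← Equiv.Perm.mem_alternatingGroup, ← heq, Subgroup.mem_map]
  constructor
  · intro hz; exact ⟨z, hz, rfl⟩
  · rintro ⟨w, hw, hwz⟩
    rw [MulEquiv.coe_toMonoidHom] at hwz
    rwa [← ψ.injective hwz]

end Transport

/-! ### Frobenius divisions and splitting types -/

section Field

variable {N : Type} [Field N] [NumberField N] [IsGalois ℚ N] {n : ℕ} [NeZero n]
  (K' : IntermediateField ℚ N) (ψ : (N ≃ₐ[ℚ] N) ≃* Equiv.Perm (Fin n))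
  (hstab : ∀ g : N ≃ₐ[ℚ] N, g ∈ K'.fixingSubgroup ↔ ψ g 0 = 0)

include hstab in
/-- **Dedekind's dictionary along `ψ`**: if `φ` is a Frobenius at `Q ∣ p` with trivial inertia, then
`splittingType K' p` is the full cycle type of `ψ φ`. [cite: Perlis1977, §1] -/
theorem splittingType_eq_fullCycleType {p : ℕ} (hp : p.Prime) (Q : Ideal (𝓞 N)) [Q.IsMaximal]
    [Q.LiesOver (span {(p : ℤ)})] {φ : N ≃ₐ[ℚ] N} (hφ : IsArithFrobAt ℤ φ Q)
    (hI : Q.inertia (N ≃ₐ[ℚ] N) = ⊥) :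
    splittingType K' p = (ψ φ).cycleType + Multiset.replicate (n - (ψ φ).support.card) 1 := by
  classical
  have hA : 0 < (Finset.univ.filter fun q : Equiv.Perm (Fin n) => q 0 = 0).card :=
    Finset.card_pos.mpr ⟨1, Finset.mem_filter.mpr ⟨Finset.mem_univ _, rfl⟩⟩
  have hsums : ∀ j : ℕ, ((splittingType K' p).filter (· ∣ j)).sum =
      (((ψ φ).cycleType + Multiset.replicate (Fintype.card (Fin n) - (ψ φ).support.card) 1).filter
        (· ∣ j)).sum := by
    intro j
    have hk := card_fixingSubgroup_mul_sum_filter_dvd K' hp Q hφ hI j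
    rw [natCard_subgroup_eq_card_filter_perm ψ K'.fixingSubgroup (fun q => q 0 = 0) hstab,
      natCard_conj_mem_eq_card_filter_perm ψ K'.fixingSubgroup (fun q => q 0 = 0) hstab, map_pow,
      card_filter_conj_apply_zero] at hk
    rw [sum_filter_dvd_fullCycleType, ← Nat.eq_of_mul_eq_mul_left hA hk]
  have h := eq_of_forall_sum_filter_dvd_eq _ _ _ rfl (fun f hf => splittingType_pos hp hf)
    (fun f hf => pos_of_mem_fullCycleType (ψ φ) hf) hsums
  simpa only [Fintype.card_fin] using h

include hstab in
/-- **Frobenius divisions are splitting types.**  For a prime `p ∤ d_N` and `σ ∈ Gal(N/ℚ)`: there is a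
prime `Q ∣ p` of `N` with trivial inertia whose Frobenius `φ` satisfies `⟨gφg⁻¹⟩ = ⟨σ⟩` for some `g`
iff the splitting type of `p` in `K'` is the full cycle type of `ψ σ`. [cite: Perlis1977, §1]
[cite: LagariasMontgomeryOdlyzko1979, §1] -/
theorem frobenius_division_iff_splittingType_eq (σ : N ≃ₐ[ℚ] N) {p : ℕ} (hp : p.Prime)
    (hpN : ¬ ((p : ℤ) ∣ NumberField.discr N)) :
    (∃ (Q : Ideal (𝓞 N)) (_ : Q.IsMaximal) (_ : Q.LiesOver (span {(p : ℤ)})) (φ g : N ≃ₐ[ℚ] N),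
        IsArithFrobAt ℤ φ Q ∧ Q.inertia (N ≃ₐ[ℚ] N) = ⊥ ∧
          Subgroup.zpowers (g * φ * g⁻¹) = Subgroup.zpowers σ) ↔
      splittingType K' p = (ψ σ).cycleType + Multiset.replicate (n - (ψ σ).support.card) 1 := by
  classical
  constructor
  · rintro ⟨Q, hQmax, hQover, φ, g, hφ, hI, hg⟩
    rw [splittingType_eq_fullCycleType K' ψ hstab hp Q hφ hI]
    have hg' : Subgroup.zpowers (ψ g * ψ φ * (ψ g)⁻¹) = Subgroup.zpowers (ψ σ) :=
      zpowers_conj_eq_of_mulEquiv ψ hg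
    have h := (exists_conj_zpowers_eq_iff_fullCycleType_eq (ψ σ) (ψ φ)).mp ⟨ψ g, hg'⟩
    simpa only [Fintype.card_fin] using h
  · intro hT
    obtain ⟨Q, hQmax, hQover, ⟨φ, hφ⟩, hI⟩ := exists_isArithFrobAt_of_not_dvd_discr (N := N) hp hpN
    have hφT := splittingType_eq_fullCycleType K' ψ hstab hp Q hφ hI
    rw [hT] at hφT
    have hc : IsConj (ψ φ) (ψ σ) := Equiv.Perm.isConj_of_cycleType_eq (by
      have h := cycleType_eq_of_fullCycleType_eq (σ := ψ σ) (τ := ψ φ) (by simpa only [Fintype.card_fin] using hφT)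
      exact h.symm)
    have hc' : IsConj φ σ := by
      have := MonoidHom.map_isConj ψ.symm.toMonoidHom hc
      simpa using this
    obtain ⟨g, hg⟩ := isConj_iff.mp hc'
    exact ⟨Q, hQmax, hQover, φ, g, hφ, hI, by rw [hg]⟩

end Field

end Summit.QuantumAdvantage.QuantumAdvantage.Theorems.DegreeOnePrimesEscape

end
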